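import Summits.QuantumFields.YangMills.Theorems.BalabanUVNodesN15DerivDefect

/-!
# Route «BalabanUVNodes» (K4 «SpineRates»), node N15 = NE2, BACKGROUND LAYER — first missing estimate, part 2/3: THE η-DEFECT OF THE
# LATTICE DERIVATIVE IS SMALL ONLY INSIDE COMPOSITES — one factor `η′(M − 1) ≤ η` against the adjoint-derivative entry of the fine left
# factor and the derivative entry of the coarse right factor (block-majorant currency of `B11SectG`)

Cell `pub-ymgap`, seat `pub-ymgap-dag-n15-b` (D-0062; `bears_on: R4∕N15`; `--supports stmt-QuantumFields-19351`).  Part 1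
(`BalabanUVNodesN15DerivDefect`) proved the exact algebra of the record's item S5 (`pub-balaban/t4/T4-EST-U1a.md` §16): `𝔇(∇′_{η′}, ∇_η)
= M_χ ∘ pull π ∘ ∇_η` with `χ = M·1_{face} − 1` (order one pointwise) and the discrete integration `M_χ ∘ pull π = ∇′* ∘ stair`.  THIS FILE
is the ESTIMATE half of S5 («then its majorant ONLY INSIDE COMPOSITES»), in the sharp cube norms `B11SectG.BlockNorm.ofBlocks g blk` (coarse
lattice `X`, cubes `blk : X → 𝔅`) and `ofBlocks g (blk ∘ π)` (fine lattice) — the input∕output currency of `T4EtaRateDefect.idef_neumann_majorant`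
and of `T4EtaRateCoeffDefect`:
* `hasMaj_mulOp_chi_pull` — the HONEST POINTWISE SIZE `diagK (M − 1)` of `M_χ ∘ pull π` (no cancellation; part 3 shows it is attained);
* `hasMaj_smul_stair` — the scaled staircase `c•stair` has majorant `diagK (|c|(M − 1))`;
* `hasMaj_idef_fdiffN_comp` — NO CANCELLATION: `𝔇(∇′_{η′}, ∇_η) ∘ G` has majorant `(M − 1)·K₁` from a majorant `K₁` of `∇_η ∘ G`;
* **`hasMaj_comp_idef_fdiffN_comp`** — THE ESTIMATE: from a majorant `K₃ ≥ 0` of the fine left factor's ADJOINT-DERIVATIVE ENTRY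
  `S′ ∘ ∇′*_{η′}` (printed SHAPE [Balaban1985BackgroundPropagators] Thm 3.1 (3.42) p. 397, third entry «|G′∇*_U λ| ≤ B₀·L^jη·e^{−δ₀d(y,y′)}|λ|»,
  one power of `L^jη` below the zeroth entry) and a majorant `K₁` of the coarse right factor's derivative entry `∇_η ∘ G` ((3.42)₂ of the
  coarse run), the Leibniz summand `S′·𝔇(∇′_{η′}, ∇_η)·G` of `T4EtaRateDefect.idef_comp` has majorant `|η′|(M − 1)·(K₃ ⋆ K₁)`, and
  `|η′|(M − 1) ≤ η` (`abs_eta'_mul_pred_le`, `hasMaj_comp_idef_fdiffN_comp_eta`);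
* `rate_reading_deriv` — (R1) of the record: with `K₃ = B₃·ℓ·e`, `ℓ = L^jη` the scale of the FINE LEFT factor, the defect term `η·B₃ℓ·e` IS
  `(B₃ℓ²e)·(η∕ℓ)`: the undifferentiated (3.42)₀-size times ONE rate factor `η∕ℓ = T4EtaRate.rateFactor g 1 y`
  (`T4EtaRateCoeffDefect.rateFactor_one`) — the same covariance `γ = 1` as the coefficient half (`T4EtaRateCoeffDefect.rate_reading`).

HONEST FRAMING ∕ LIMITS.  MECHANISM ONLY: `K₃`, `K₁`, the cubes and the line data are binders; the intermediate norm between `S′∘∇′*` and the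
staircase is the SHARP fine-cube norm (κ = 1) — weighted∕Hölder intermediate norms not treated; nothing of [B9] asserted ((3.42)₃ is the SHAPE of
one binder).  NE2⁺ NOT PRINTED, NOT proved; count-neutral; one finite T⁴ at fixed ε — NOT infinite volume, NOT OS on ℝ⁴, NOT a mass gap,
NOT Clay.
-/

noncomputable section

namespace Summit.QuantumFields.YangMills.BalabanUVNodes.N15.DerivDefect

open Literature.MathematicalPhysics.QuantumFieldTheory.Balaban1983to89
open Literature.MathematicalPhysics.QuantumFieldTheory.Balaban1983to89.B11SectG (BlockNorm HasMaj hasMaj_comp)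
open Literature.MathematicalPhysics.QuantumFieldTheory.Balaban1983to89.T4EtaRateDefect (idef)
open Literature.MathematicalPhysics.QuantumFieldTheory.Balaban1983to89.T4EtaRateCoeffDefect (pull pull_apply diagK
  diagK_same diagK_ne diagK_nonneg loc_fine_mul_pull_le)
open Literature.MathematicalPhysics.QuantumFieldTheory.Balaban1983to89.B11AxialTransport190 (abs_le_loc_ofBlocks
  loc_ofBlocks_le)
open Literature.MathematicalPhysics.QuantumFieldTheory.Balaban1983to89.B6Prop26Gluing (mulOp mulOp_apply)
open Literature.MathematicalPhysics.QuantumLattice (blockMap)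

/-! ## §5 The majorants: order one pointwise, one factor `η′(M − 1) ≤ η` inside composites -/

section Majorant

variable {X X' : Type} [Fintype X] [Fintype X'] {g : B6.Geometry} (D : LineData X X') (blk : X → g.Site)

/-- Diagonal kernels collapse 𝔅-sums on the left. [folklore] -/
theorem sum_diagK_mul (o : g.Site → ℝ) (F : g.Site → ℝ) (a : g.Site) :
    ∑ y'', diagK o a y'' * F y'' = o a * F a := by
  classical
  rw [Finset.sum_eq_single a]
  · rw [diagK_same]
  · intro y'' _ hy
    rw [diagK_ne o (Ne.symm hy), zero_mul]
  · intro ha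
    exact absurd (Finset.mem_univ a) ha

/-- Diagonal kernels collapse 𝔅-sums on the right. [folklore] -/
theorem sum_mul_diagK (o : g.Site → ℝ) (F : g.Site → ℝ) (b : g.Site) :
    ∑ y'', F y'' * diagK o y'' b = F b * o b := by
  classical
  rw [Finset.sum_eq_single b]
  · rw [diagK_same]
  · intro y'' _ hy
    rw [diagK_ne o hy, mul_zero]
  · intro hb
    exact absurd (Finset.mem_univ b) hb

/-- THE HONEST POINTWISE SIZE: `M_χ ∘ pull π` has the diagonal majorant `diagK (M − 1)` between the sharp cube norms of
the coarse and of the fine lattice — order one, growing with the spacing ratio. [folklore] -/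
theorem hasMaj_mulOp_chi_pull :
    HasMaj (BlockNorm.ofBlocks g blk) (BlockNorm.ofBlocks g (blk ∘ D.π)) (mulOp D.chi ∘ₗ pull D.π)
      (diagK fun _ => (D.M : ℝ) - 1) := by
  intro y' μ hμ y
  have hfun : (mulOp D.chi ∘ₗ pull D.π) μ = fun x' => D.chi x' * μ (D.π x') := rfl
  rw [hfun]
  exact loc_fine_mul_pull_le blk D.π (fun _ => by linarith [D.one_le_M_real]) (fun x' => D.abs_chi_le x') hμ y

/-- A SCALED STAIRCASE `cꞏΦ` has the diagonal majorant `diagK (|c|(M − 1))` (the staircase carries the small factor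
`c = η′` in §4's composite identity). [folklore] -/
theorem hasMaj_smul_stair (c : ℝ) :
    HasMaj (BlockNorm.ofBlocks g blk) (BlockNorm.ofBlocks g (blk ∘ D.π)) (c • D.stair)
      (diagK fun _ => |c| * ((D.M : ℝ) - 1)) := by
  intro y' μ hμ y
  have hfun : (c • D.stair) μ = fun x' => (c * D.stairCoeff x') * μ (D.π x') := by
    funext x'
    simp only [LinearMap.smul_apply, Pi.smul_apply, LineData.stair_apply, smul_eq_mul, mul_assoc]
  rw [hfun]
  refine loc_fine_mul_pull_le blk D.π (fun _ => mul_nonneg (abs_nonneg c) (by linarith [D.one_le_M_real]))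
    (fun x' => ?_) hμ y
  rw [abs_mul]
  exact mul_le_mul_of_nonneg_left (D.abs_stairCoeff_le x') (abs_nonneg c)

/-- NO CANCELLATION USED: from a majorant `K₁` of the coarse derivative entry `∇_η ∘ G`, the defect composite
`𝔇(∇′_{η′}, ∇_η) ∘ G` has majorant `(M − 1)ꞏK₁` into the fine cubes — the face term at full size `M − 1 ≈ η/η′`.
[folklore] -/
theorem hasMaj_idef_fdiffN_comp {F₁ : Type} [AddCommGroup F₁] [Module ℝ F₁] {b₁ : BlockNorm g F₁}
    {η η' : ℝ} (hη' : η' ≠ 0) (hMη : (D.M : ℝ) * η' = η) {G : F₁ →ₗ[ℝ] (X → ℝ)} {K₁ : g.Site → g.Site → ℝ}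
    (hG : HasMaj b₁ (BlockNorm.ofBlocks g blk) (fdiffN η D.s ∘ₗ G) K₁) :
    HasMaj b₁ (BlockNorm.ofBlocks g (blk ∘ D.π))
      (idef (pull D.π) (pull D.π) (fdiffN η' D.s') (fdiffN η D.s) ∘ₗ G) (fun y y' => ((D.M : ℝ) - 1) * K₁ y y') := by
  have hop : idef (pull D.π) (pull D.π) (fdiffN η' D.s') (fdiffN η D.s) ∘ₗ G =
      (mulOp D.chi ∘ₗ pull D.π) ∘ₗ (fdiffN η D.s ∘ₗ G) := by
    rw [idef_fdiffN_eq D hη' hMη]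
    rfl
  rw [hop]
  have key := hasMaj_comp (hasMaj_mulOp_chi_pull D blk) hG
    (diagK_nonneg fun _ => by linarith [D.one_le_M_real])
  have hκ : (BlockNorm.ofBlocks g blk).κ = 1 := rfl
  refine key.mono fun a b => le_of_eq ?_
  simp only [hκ, one_mul]
  exact sum_diagK_mul _ _ _

/-- **THE ESTIMATE INSIDE COMPOSITES.**  Let `S′` be a fine-lattice left factor whose ADJOINT-DERIVATIVE ENTRY
`S′ ∘ ∇′*_{η′}` has a majorant `K₃ ≥ 0` out of the fine cubes (printed SHAPE: (3.42)₃, `|G′∇*_Uλ| ≤ B₀(L^jη)e^{−δ₀d}|λ|`), and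
`G` a coarse right factor whose derivative entry `∇_η ∘ G` has a majorant `K₁` into the coarse cubes.  Then the Leibniz
summand `S′ꞏ𝔇(∇′_{η′}, ∇_η)ꞏG` of `T4EtaRateDefect.idef_comp` has majorant `|η′|(M − 1)ꞏΣ_{y″} K₃(y,y″)K₁(y″,y′)`: ONE
factor `η′(M − 1) ≤ η` against the product of the two derivative entries. [cite: Balaban1985BackgroundPropagators, Thm 3.1 (3.42) p.397 (third entry: shape of `K₃`)] -/
theorem hasMaj_comp_idef_fdiffN_comp {F₁ F₃ : Type} [AddCommGroup F₁] [Module ℝ F₁] [AddCommGroup F₃] [Module ℝ F₃]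
    {b₁ : BlockNorm g F₁} {b₃ : BlockNorm g F₃} {η η' : ℝ} (hη' : η' ≠ 0) (hMη : (D.M : ℝ) * η' = η)
    {S' : (X' → ℝ) →ₗ[ℝ] F₃} {G : F₁ →ₗ[ℝ] (X → ℝ)} {K₃ K₁ : g.Site → g.Site → ℝ} (hK₃ : ∀ a b, 0 ≤ K₃ a b)
    (hS : HasMaj (BlockNorm.ofBlocks g (blk ∘ D.π)) b₃ (S' ∘ₗ bdiffN η' D.s') K₃)
    (hG : HasMaj b₁ (BlockNorm.ofBlocks g blk) (fdiffN η D.s ∘ₗ G) K₁) :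
    HasMaj b₁ b₃ (S' ∘ₗ idef (pull D.π) (pull D.π) (fdiffN η' D.s') (fdiffN η D.s) ∘ₗ G)
      (fun y y' => |η'| * ((D.M : ℝ) - 1) * ∑ y'', K₃ y y'' * K₁ y'' y') := by
  rw [comp_idef_fdiffN_comp D hη' hMη S' G]
  -- right two factors: the scaled staircase after the coarse derivative entry
  have hκ : (BlockNorm.ofBlocks g blk).κ = 1 := rfl
  have hκ' : (BlockNorm.ofBlocks g (blk ∘ D.π)).κ = 1 := rfl
  have hA : HasMaj b₁ (BlockNorm.ofBlocks g (blk ∘ D.π)) ((η' • D.stair) ∘ₗ (fdiffN η D.s ∘ₗ G))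
      (fun a b => |η'| * ((D.M : ℝ) - 1) * K₁ a b) := by
    have key := hasMaj_comp (hasMaj_smul_stair D blk η') hG
      (diagK_nonneg fun _ => mul_nonneg (abs_nonneg _) (by linarith [D.one_le_M_real]))
    refine key.mono fun a b => le_of_eq ?_
    simp only [hκ, one_mul]
    exact sum_diagK_mul _ _ _
  have key := hasMaj_comp hS hA hK₃
  refine key.mono fun a b => le_of_eq ?_
  simp only [hκ', one_mul]
  rw [Finset.mul_sum]
  exact Finset.sum_congr rfl fun y'' _ => by ring

/-- THE ONE FACTOR IS AT MOST THE COARSE SPACING: `|η′|ꞏ(M − 1) ≤ η` for `Mη′ = η`, `η′ ≥ 0`. [folklore] -/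
theorem abs_eta'_mul_pred_le {M : ℕ} {η η' : ℝ} (hη' : 0 ≤ η') (hMη : (M : ℝ) * η' = η) :
    |η'| * ((M : ℝ) - 1) ≤ η := by
  rw [abs_of_nonneg hη']
  nlinarith

/-- The composite estimate with the factor `η` (coarse spacing) displayed. [folklore] -/
theorem hasMaj_comp_idef_fdiffN_comp_eta {F₁ F₃ : Type} [AddCommGroup F₁] [Module ℝ F₁] [AddCommGroup F₃]
    [Module ℝ F₃] {b₁ : BlockNorm g F₁} {b₃ : BlockNorm g F₃} {η η' : ℝ} (hη' : 0 < η') (hMη : (D.M : ℝ) * η' = η)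
    {S' : (X' → ℝ) →ₗ[ℝ] F₃} {G : F₁ →ₗ[ℝ] (X → ℝ)} {K₃ K₁ : g.Site → g.Site → ℝ} (hK₃ : ∀ a b, 0 ≤ K₃ a b)
    (hK₁ : ∀ a b, 0 ≤ K₁ a b)
    (hS : HasMaj (BlockNorm.ofBlocks g (blk ∘ D.π)) b₃ (S' ∘ₗ bdiffN η' D.s') K₃)
    (hG : HasMaj b₁ (BlockNorm.ofBlocks g blk) (fdiffN η D.s ∘ₗ G) K₁) :
    HasMaj b₁ b₃ (S' ∘ₗ idef (pull D.π) (pull D.π) (fdiffN η' D.s') (fdiffN η D.s) ∘ₗ G)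
      (fun y y' => η * ∑ y'', K₃ y y'' * K₁ y'' y') := by
  refine (hasMaj_comp_idef_fdiffN_comp D blk hη'.ne' hMη hK₃ hS hG).mono fun a b => ?_
  exact mul_le_mul_of_nonneg_right (abs_eta'_mul_pred_le hη'.le hMη)
    (Finset.sum_nonneg fun y'' _ => mul_nonneg (hK₃ _ _) (hK₁ _ _))

/-- THE RATE READING ((R1) of `t4/T4-EST-U1a.md`, as for the coefficient half): if the left factor's adjoint-derivative
entry has the printed SHAPE `K₃ = B₃ꞏℓꞏe`, one power of its scale `ℓ = L^jη` below its undifferentiated size `B₃ℓ²ꞏe`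
((3.42): prefactors `[(L^jη)², L^jη, L^jη, 1]`), then the defect term `ηꞏB₃ℓꞏe` IS `(B₃ℓ²e)ꞏ(η/ℓ)` — the undifferentiated
size times ONE rate factor `η/ℓ = T4EtaRate.rateFactor g 1 y` (`T4EtaRateCoeffDefect.rateFactor_one`), `γ = 1` at the
scale of the FINE LEFT factor. [cite: Balaban1985BackgroundPropagators, Thm 3.1 (3.42) p.397 (prefactors)] -/
theorem rate_reading_deriv {η B₃ ℓ e : ℝ} (hℓ : ℓ ≠ 0) : η * (B₃ * ℓ * e) = (B₃ * ℓ ^ 2 * e) * (η / ℓ) := by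
  field_simp

end Majorant

end Summit.QuantumFields.YangMills.BalabanUVNodes.N15.DerivDefect
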